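import Mathlib.AlgebraicGeometry.Morphisms.UniversallyOpen
import Mathlib.AlgebraicGeometry.Morphisms.Preimmersion
import Mathlib.AlgebraicGeometry.ResidueField
import Mathlib.AlgebraicGeometry.PullbackCarrier
import HarnessLib

/-!
# Sections through opens which are dense in the fibre over a (non-rational) point

Topic `AlgebraicGeometry/GroupSchemes`, namespace `Literature.AlgebraicGeometry.GroupSchemes`.
THEOREMS ONLY (no definition, no named fact, no instance, no `sorry`).

The «generic section» device of Weil's group-chunk construction ([Artin1986NeronModels] §2, first
paragraph of the proof and Lemma 2.3: «choose `x` generic … Let `x` be a section of `V`»; the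
hypothesis of Thm. (1.12) «the Zariski-local sections of `V/S` are dense in each fibre») made honest
for SCHEME points. Let `p : V ⟶ S`, `q : Y ⟶ S`, let `y` be a point of `Y` over `s = q y`, and let
`O ⊆ V ×_S Y` be an open subset which is DENSE IN THE FIBRE of `pr₂ : V ×_S Y ⟶ Y` over `y` (this is
how strictness of a birational group law is stated, `BirationalGroupLaw.IsStrict`,
`Literature/AlgebraicGeometry/GroupSchemes/StrictBirationalGroupLaw`). A SECTION `x : S ⟶ V` of `p`
defines the point `(x, y) := (x ∘ q, 𝟙) (y)` of `V ×_S Y` over `y`. When `y` is not a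
`κ(s)`-rational point, the fibre of `pr₂` over `y` is `V_s ⊗_{κ(s)} κ(y)`, NOT `V_s`, so density of
`O` in that fibre does not literally say that `(x, y) ∈ O` for `x(s)` in a dense open of `V_s`. The
bridge:

* **`exists_open_forall_section_lift_mem`** — there is an open `Ω ⊆ V` meeting the fibre `V_s`
  such that EVERY section `x` with `x(s) ∈ Ω` has `(x, y) ∈ O`.

Proof: the fibre `F = V_s ⊗_{κ(s)} κ(y)` maps to `V_s` by a base change of `Spec κ(y) ⟶ Spec κ(s)`,
which is UNIVERSALLY OPEN (Mathlib: any morphism to the spectrum of a field is), so the image of the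
dense open `O ∩ F` is open in `V_s`; and over a `κ(s)`-RATIONAL point `x(s)` the fibre `F` has
exactly ONE point, namely `(x, y)`. Combined with «sections are dense in every fibre» (node W1e of
road W, `Literature/AlgebraicGeometry/Smoothening/SmoothSectionsDense`) and irreducibility of `V_s`,
finitely many such conditions are met by one section (`exists_section_forall_lift_mem_of_forall`).
Cell `hodgecm-mathlib`, road W toward `r₀` (Weil's group chunk, node W1b-β); banked leaf, no floor
change.

## References
* [Artin1986NeronModels] M. Artin, *Néron models*, in Cornell–Silverman (eds.), *Arithmetic
  Geometry*, Springer 1986, Thm. (1.12) and §2, Lemma 2.3 (pp. 217, 221–222).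
* [EdixhovenRomagny] B. Edixhoven, M. Romagny, *Group schemes out of birational group laws, Néron
  models*, Panor. Synthèses 47 (2015), Def. 3.4 (2) (strictness quantified over `T`-points).
-/

set_option autoImplicit false

noncomputable section

open CategoryTheory CategoryTheory.Limits AlgebraicGeometry TopologicalSpace Topology

namespace Literature.AlgebraicGeometry.GroupSchemes

universe u

variable {V Y S : Scheme.{u}} (p : V ⟶ S) (q : Y ⟶ S)

/-- The point `(x, y)` of `V ×_S Y` defined by a section `x` of `p : V ⟶ S` and a point `y` of `Y`:
the image of `y` under `(x ∘ q, 𝟙) : Y ⟶ V ×_S Y`; it lies over `y`. [folklore] -/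
private theorem sectionLift_snd (x : S ⟶ V) (hx : x ≫ p = 𝟙 S) :
    pullback.lift (q ≫ x) (𝟙 Y) (by rw [Category.assoc, hx, Category.comp_id, Category.id_comp]) ≫
      pullback.snd p q = 𝟙 Y :=
  pullback.lift_snd _ _ _

/-- **Sections through an open dense in the fibre over a point.** Let `p : V ⟶ S`, `q : Y ⟶ S`,
`y ∈ Y` with `s = q y`, and let `O ⊆ V ×_S Y` be open and dense in the fibre of
`pr₂ : V ×_S Y ⟶ Y` over `y`. If the fibre `V_s` is non-empty, there is an open `Ω ⊆ V` meeting
`V_s` such that for every section `x` of `p` with `x(s) ∈ Ω` the point `(x, y) = (x ∘ q, 𝟙)(y)` of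
`V ×_S Y` lies in `O`. (The fibre over `y` is `V_s ⊗_{κ(s)} κ(y)`, universally open over `V_s`, and
has a single point over the `κ(s)`-rational point `x(s)`.) This is the scheme-point form of
«choose a section `x` generic in the fibre» in [Artin1986NeronModels] §2 (proof of Lemma 2.3).
[cite: Artin1986NeronModels, §2, Lemma 2.3 (p. 222) and Thm. (1.12) (p. 217)]
[cite: EdixhovenRomagny, Def. 3.4 (2)] -/
theorem exists_open_forall_section_lift_mem (y : Y) (O : (pullback p q).Opens)
    (hO : (pullback.snd p q) ⁻¹' {y} ⊆ closure ((O : Set ↑(pullback p q)) ∩ (pullback.snd p q) ⁻¹' {y}))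
    (hs : (p ⁻¹' {q y}).Nonempty) :
    ∃ Ω : V.Opens, ((Ω : Set V) ∩ p ⁻¹' {q y}).Nonempty ∧
      ∀ (x : S ⟶ V) (hx : x ≫ p = 𝟙 S), x (q y) ∈ Ω →
        pullback.lift (q ≫ x) (𝟙 Y)
          (by rw [Category.assoc, hx, Category.comp_id, Category.id_comp]) y ∈ O := by
  -- notation: `ks : Spec κ(s) ⟶ S`, `ky : Spec κ(y) ⟶ Y`, `r : Spec κ(y) ⟶ Spec κ(s)`
  set s := q y with hs_def
  let ks := S.fromSpecResidueField s
  let ky := Y.fromSpecResidueField y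
  let r := Spec.map (q.residueFieldMap y)
  have hr : r ≫ ks = ky ≫ q := q.SpecMap_residueFieldMap_fromSpecResidueField y
  -- the fibre `V_s` and `F = V_s ⊗_{κ(s)} κ(y)` with its universally open projection `g : F ⟶ V_s`
  let j := pullback.fst p ks
  have hVs : IsPullback j (pullback.snd p ks) p ks := IsPullback.of_hasPullback p ks
  let g := pullback.fst (pullback.snd p ks) r
  let g' := pullback.snd (pullback.snd p ks) r
  have hF : IsPullback g g' (pullback.snd p ks) r := IsPullback.of_hasPullback _ _
  -- `F` is the fibre product `V ×_S Spec κ(y)`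
  have hFV : IsPullback (g ≫ j) g' p (r ≫ ks) := hF.paste_horiz hVs
  -- the map `κ : F ⟶ V ×_S Y` and `F` as the fibre of `pr₂` over `y`
  have hPV : IsPullback (pullback.fst p q) (pullback.snd p q) p q := IsPullback.of_hasPullback p q
  let κ : pullback (pullback.snd p ks) r ⟶ pullback p q :=
    pullback.lift (g ≫ j) (g' ≫ ky) (by rw [hFV.w, Category.assoc, hr])
  have hκ₁ : κ ≫ pullback.fst p q = g ≫ j := pullback.lift_fst _ _ _
  have hκ₂ : κ ≫ pullback.snd p q = g' ≫ ky := pullback.lift_snd _ _ _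
  have hFfib : IsPullback κ g' (pullback.snd p q) ky := by
    refine IsPullback.of_right (h₁₂ := pullback.fst p q) (h₂₂ := q) ?_ hκ₂ hPV
    rw [hκ₁, ← hr]
    exact hFV
  have hκrange : Set.range κ = (pullback.snd p q) ⁻¹' {y} := by
    rw [← Scheme.range_fromSpecResidueField y]
    have hfac : κ = hFfib.isoPullback.hom ≫ pullback.fst (pullback.snd p q) ky := by
      rw [IsPullback.isoPullback_hom_fst]
    have hsurj : Function.Surjective hFfib.isoPullback.hom := hFfib.isoPullback.hom.homeomorph.surjective
    rw [hfac, Scheme.Hom.comp_base, TopCat.coe_comp, Set.range_comp, Set.range_eq_univ.mpr hsurj,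
      Set.image_univ, Scheme.Pullback.range_fst]
  -- `g : F ⟶ V_s` is an open map; `j : V_s ⟶ V` is an embedding onto the fibre
  haveI : UniversallyOpen r := inferInstance
  have hgo : IsOpenMap g := g.isOpenMap
  have hjr : Set.range j = p ⁻¹' {s} := by
    rw [Scheme.Pullback.range_fst, Scheme.range_fromSpecResidueField]
  have hje : IsEmbedding j := j.isEmbedding
  -- the open `W = κ⁻¹ O` of `F` is non-empty
  set W : Set ↑(pullback (pullback.snd p ks) r) := κ ⁻¹' (O : Set ↑(pullback p q)) with hW
  have hWo : IsOpen W := O.2.preimage κ.continuous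
  have hWne : W.Nonempty := by
    -- a point of `V_s`, hence of `F` (the projection `F ⟶ V_s` is surjective), hence of the fibre
    haveI : Surjective r := inferInstance
    haveI : Surjective g := inferInstance
    obtain ⟨v, hv⟩ := hs
    obtain ⟨vs, hvs⟩ : v ∈ Set.range j := by rw [hjr]; exact hv
    obtain ⟨w₀, -⟩ := g.surjective vs
    have hz : κ w₀ ∈ (pullback.snd p q) ⁻¹' {y} := by rw [← hκrange]; exact ⟨w₀, rfl⟩
    have hz' : ((O : Set ↑(pullback p q)) ∩ (pullback.snd p q) ⁻¹' {y}).Nonempty := by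
      by_contra hne
      rw [Set.not_nonempty_iff_eq_empty] at hne
      have := hO hz
      rw [hne, closure_empty] at this
      exact this
    obtain ⟨z₁, hz₁O, hz₁y⟩ := hz'
    obtain ⟨w₁, rfl⟩ : z₁ ∈ Set.range κ := by rw [hκrange]; exact hz₁y
    exact ⟨w₁, hz₁O⟩
  -- the open `Ω ⊆ V`: `g '' W` is open in `V_s`, and `j` is an embedding
  have hgW : IsOpen (g '' W) := hgo _ hWo
  obtain ⟨Ωs, hΩo, hΩ⟩ := hje.isInducing.image_eq_isOpen_inter_range hgW
  refine ⟨⟨Ωs, hΩo⟩, ?_, ?_⟩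
  · obtain ⟨w, hw⟩ := hWne
    have hmem : j (g w) ∈ j '' (g '' W) := ⟨g w, ⟨w, hw, rfl⟩, rfl⟩
    rw [hΩ] at hmem
    refine ⟨j (g w), hmem.1, ?_⟩
    rw [← hjr]
    exact ⟨g w, rfl⟩
  · intro x hx hxΩ
    -- `x(s)` lies in the fibre, hence `x(s) = j (g w₁)` for some `w₁ ∈ W`
    have hpx : p (x s) = s := by
      have h := congrArg (fun φ : S ⟶ S => φ s) hx
      simpa only [Scheme.Hom.comp_base, TopCat.comp_app, Scheme.Hom.id_base, TopCat.id_app] using h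
    have hxs : x s ∈ j '' (g '' W) := by
      rw [hΩ]
      refine ⟨hxΩ, ?_⟩
      rw [hjr]
      exact hpx
    obtain ⟨_, ⟨w₁, hw₁W, rfl⟩, hw₁⟩ := hxs
    -- the `κ(y)`-point `x_F = (x ∘ q ∘ k_y, 𝟙)` of `F` and the pullback square over the section `x`
    have hcomm : (ky ≫ q ≫ x) ≫ p = 𝟙 _ ≫ r ≫ ks := by
      rw [Category.assoc, Category.assoc, hx, Category.comp_id, Category.id_comp, hr]
    let xF := hFV.lift (ky ≫ q ≫ x) (𝟙 _) hcomm
    have hxF₁ : xF ≫ g ≫ j = ky ≫ q ≫ x := hFV.lift_fst _ _ _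
    have hxF₂ : xF ≫ g' = 𝟙 _ := hFV.lift_snd _ _ _
    have big : IsPullback (ky ≫ q) (xF ≫ g') (x ≫ p) (r ≫ ks) := by
      rw [hxF₂, hx, hr]
      exact IsPullback.of_id_snd
    have Q1 : IsPullback (ky ≫ q) xF x (g ≫ j) :=
      IsPullback.of_bot big (by rw [hxF₁, Category.assoc]) hFV
    -- hence the fibre of `F ⟶ V` over `x(s)` is the single point `x_F`
    have hrangexF : Set.range xF = (g ≫ j) ⁻¹' Set.range x := by
      have hfac : xF = Q1.isoPullback.hom ≫ pullback.snd x (g ≫ j) := by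
        rw [IsPullback.isoPullback_hom_snd]
      have hsurj : Function.Surjective Q1.isoPullback.hom := Q1.isoPullback.hom.homeomorph.surjective
      rw [hfac, Scheme.Hom.comp_base, TopCat.coe_comp, Set.range_comp, Set.range_eq_univ.mpr hsurj,
        Set.image_univ, Scheme.Pullback.range_snd]
    have hw₁x : w₁ ∈ (g ≫ j) ⁻¹' Set.range x := ⟨s, hw₁.symm⟩
    rw [← hrangexF] at hw₁x
    obtain ⟨t, rfl⟩ := hw₁x
    -- and `κ x_F = (x, y)`
    have hκxF : xF ≫ κ = ky ≫ pullback.lift (q ≫ x) (𝟙 Y)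
        (by rw [Category.assoc, hx, Category.comp_id, Category.id_comp]) := by
      apply pullback.hom_ext
      · rw [Category.assoc, hκ₁, hxF₁, Category.assoc, pullback.lift_fst]
      · rw [Category.assoc, hκ₂, ← Category.assoc, hxF₂, Category.id_comp, Category.assoc,
          pullback.lift_snd, Category.comp_id]
    have hpt : κ (xF t) = pullback.lift (q ≫ x) (𝟙 Y)
        (by rw [Category.assoc, hx, Category.comp_id, Category.id_comp]) y := by
      have h := congrArg (fun φ => φ t) hκxF
      simp only [Scheme.Hom.comp_base, TopCat.comp_app] at h
      rw [h, Scheme.fromSpecResidueField_apply]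
    rw [← hpt]
    exact hw₁W

/-- **A section through an open meeting a fibre**, from «sections are dense in every fibre»
(the hypothesis of [Artin1986NeronModels] Thm. (1.12), in the shape `HasDenseSections` of the
road-W sub-line: for every point `v` and open `Ω ∋ v` there is a section meeting `Ω` in the fibre of
`v`): if the open `Ω ⊆ V` meets the fibre over `s`, some section `x` of `p` has `x(s) ∈ Ω`. Combine
with `exists_open_forall_section_lift_mem` (and irreducibility of the fibre, to intersect finitely
many such `Ω`). [cite: Artin1986NeronModels, Thm. (1.12) (p. 217) and §2, first paragraph of the proof (p. 221)] -/
theorem exists_section_apply_mem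
    (hsec : ∀ (v : V) (Ω : V.Opens), v ∈ Ω →
      ∃ a : S ⟶ V, a ≫ p = 𝟙 S ∧ ∃ t : S, a t ∈ Ω ∧ p (a t) = p v)
    (s : S) (Ω : V.Opens) (h : ((Ω : Set V) ∩ p ⁻¹' {s}).Nonempty) :
    ∃ x : S ⟶ V, x ≫ p = 𝟙 S ∧ x s ∈ Ω := by
  obtain ⟨v, hvΩ, hvs⟩ := h
  obtain ⟨a, ha, t, hat, hpt⟩ := hsec v Ω hvΩ
  have hsect : p (a t) = t := by
    have h := congrArg (fun φ : S ⟶ S => φ t) ha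
    simpa only [Scheme.Hom.comp_base, TopCat.comp_app, Scheme.Hom.id_base, TopCat.id_app] using h
  have hts : t = s := by rw [← hsect, hpt]; exact hvs
  exact ⟨a, ha, hts ▸ hat⟩

end Literature.AlgebraicGeometry.GroupSchemes

end
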